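import Mathlib

/-!
# The joint kernel of an equivariant family of maps on an irreducible module (support, seat p1)

The linear-algebra half of the step «`Θ_Φ(v) ≠ 0` for some `Φ`» of a theta-lift argument (memo §4, (★)): for an
irreducible module `V` (every `π`-stable submodule is `⊥` or `⊤`), a family of linear maps `T Φ : V →ₗ W` indexed
by a `G`-set `I` and EQUIVARIANT — `T (g • Φ) (π g v) = σ g (T Φ v)` — has a `π`-stable joint kernel
`⋂_Φ ker (T Φ)` (`jointKernel_stable`), hence the joint kernel is `⊥` or `⊤` (`jointKernel_eq_bot_or_top`):

  as soon as ONE vector is not killed by ALL the `T Φ`, EVERY non-zero `v` has some `Φ` with `T Φ v ≠ 0`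
  (`exists_ne_zero_of_exists_ne_zero`).

In the line: `V = π` (the irreducible automorphic representation of `U(W_A)`), `I` = the Schwartz data `Φ_f`
permuted by the Hecke translates, `T Φ = Θ_{Φ_∞ ⊗ Φ}` the theta lift, `W` the automorphic forms on `U(V)`; the
«one vector not killed» is the archimedean Fock-model computation (§4a, in words / printed), and the conclusion is
«`Θ_Φ(v_{A,π}) ≠ 0` for some Hecke translate `Φ`». The single-map case (`ker_eq_bot_or_top`,
`injective_of_exists_ne_zero`) is the trivial half of Schur's lemma.

Nothing here is about any group, any theta lift, or any period.
Blind lane: Mathlib only; no sorry; axioms ⊆ {propext, Classical.choice, Quot.sound}.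
-/

namespace Summit.Ventures.HodgeRepro2.T7SupportEquivariantKernel

variable {G : Type*} [Group G] {V W : Type*} [AddCommGroup V] [Module ℂ V] [AddCommGroup W] [Module ℂ W]

/-- irreducibility: every `π`-stable submodule is `⊥` or `⊤` -/
def IsIrreducible (π : G →* (V →ₗ[ℂ] V)) : Prop :=
  ∀ U : Submodule ℂ V, (∀ (g : G), ∀ v ∈ U, π g v ∈ U) → U = ⊥ ∨ U = ⊤

/-- the joint kernel of a family of linear maps -/
def jointKernel {I : Type*} (T : I → (V →ₗ[ℂ] W)) : Submodule ℂ V := ⨅ Φ, LinearMap.ker (T Φ)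

omit [Group G] in
/-- membership in the joint kernel -/
theorem mem_jointKernel {I : Type*} (T : I → (V →ₗ[ℂ] W)) (v : V) :
    v ∈ jointKernel T ↔ ∀ Φ, T Φ v = 0 := by
  simp [jointKernel, Submodule.mem_iInf, LinearMap.mem_ker]

/-- **the joint kernel of an equivariant family is stable**: with `T (g • Φ) (π g v) = σ g (T Φ v)` for all
`g, Φ, v` (`g` acting on the index set), `v ∈ ⋂ ker (T Φ)` implies `π g v ∈ ⋂ ker (T Φ)` -/
theorem jointKernel_stable {I : Type*} [MulAction G I] (π : G →* (V →ₗ[ℂ] V)) (σ : G →* (W →ₗ[ℂ] W))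
    (T : I → (V →ₗ[ℂ] W)) (hT : ∀ (g : G) (Φ : I) (v : V), T (g • Φ) (π g v) = σ g (T Φ v)) (g : G) :
    ∀ v ∈ jointKernel T, π g v ∈ jointKernel T := by
  intro v hv
  rw [mem_jointKernel] at hv ⊢
  intro Φ
  have e : T Φ (π g v) = T (g • (g⁻¹ • Φ)) (π g v) := by rw [smul_inv_smul]
  rw [e, hT g (g⁻¹ • Φ) v, hv (g⁻¹ • Φ), map_zero]

/-- **the joint kernel is `⊥` or `⊤`** for an irreducible `π` -/
theorem jointKernel_eq_bot_or_top {I : Type*} [MulAction G I] {π : G →* (V →ₗ[ℂ] V)} (hirr : IsIrreducible π)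
    (σ : G →* (W →ₗ[ℂ] W)) (T : I → (V →ₗ[ℂ] W))
    (hT : ∀ (g : G) (Φ : I) (v : V), T (g • Φ) (π g v) = σ g (T Φ v)) :
    jointKernel T = ⊥ ∨ jointKernel T = ⊤ :=
  hirr _ (jointKernel_stable π σ T hT)

/-- **one vector not killed by all the `T Φ` ⇒ every non-zero vector survives some `T Φ`** -/
theorem exists_ne_zero_of_exists_ne_zero {I : Type*} [MulAction G I] {π : G →* (V →ₗ[ℂ] V)}
    (hirr : IsIrreducible π) (σ : G →* (W →ₗ[ℂ] W)) (T : I → (V →ₗ[ℂ] W))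
    (hT : ∀ (g : G) (Φ : I) (v : V), T (g • Φ) (π g v) = σ g (T Φ v))
    (hne : ∃ (v₀ : V) (Φ₀ : I), T Φ₀ v₀ ≠ 0) {v : V} (hv : v ≠ 0) : ∃ Φ, T Φ v ≠ 0 := by
  rcases jointKernel_eq_bot_or_top hirr σ T hT with h | h
  · by_contra hall
    push Not at hall
    have hmem : v ∈ jointKernel T := (mem_jointKernel T v).2 hall
    rw [h, Submodule.mem_bot] at hmem
    exact hv hmem
  · obtain ⟨v₀, Φ₀, h₀⟩ := hne
    have hmem : v₀ ∈ jointKernel T := by rw [h]; exact Submodule.mem_top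
    exact absurd ((mem_jointKernel T v₀).1 hmem Φ₀) h₀

/-! ### The single-map case -/

/-- the kernel of an equivariant map is stable -/
theorem ker_stable (π : G →* (V →ₗ[ℂ] V)) (σ : G →* (W →ₗ[ℂ] W)) (T : V →ₗ[ℂ] W)
    (hT : ∀ (g : G) (v : V), T (π g v) = σ g (T v)) (g : G) :
    ∀ v ∈ LinearMap.ker T, π g v ∈ LinearMap.ker T := by
  intro v hv
  rw [LinearMap.mem_ker] at hv ⊢
  rw [hT, hv, map_zero]

/-- **the kernel of an equivariant map on an irreducible module is `⊥` or `⊤`** -/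
theorem ker_eq_bot_or_top {π : G →* (V →ₗ[ℂ] V)} (hirr : IsIrreducible π) (σ : G →* (W →ₗ[ℂ] W))
    (T : V →ₗ[ℂ] W) (hT : ∀ (g : G) (v : V), T (π g v) = σ g (T v)) :
    LinearMap.ker T = ⊥ ∨ LinearMap.ker T = ⊤ :=
  hirr _ (ker_stable π σ T hT)

/-- **a non-zero equivariant map out of an irreducible module is injective** -/
theorem injective_of_exists_ne_zero {π : G →* (V →ₗ[ℂ] V)} (hirr : IsIrreducible π) (σ : G →* (W →ₗ[ℂ] W))
    (T : V →ₗ[ℂ] W) (hT : ∀ (g : G) (v : V), T (π g v) = σ g (T v)) (hne : ∃ v₀, T v₀ ≠ 0) :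
    Function.Injective T := by
  rcases ker_eq_bot_or_top hirr σ T hT with h | h
  · exact LinearMap.ker_eq_bot.1 h
  · obtain ⟨v₀, h₀⟩ := hne
    have : v₀ ∈ LinearMap.ker T := by rw [h]; exact Submodule.mem_top
    exact absurd (LinearMap.mem_ker.1 this) h₀

end Summit.Ventures.HodgeRepro2.T7SupportEquivariantKernel
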